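import Mathlib
import Summits.Ventures.HodgeRepro.Tier4.Line1.RTFSetting
import Summits.Ventures.HodgeRepro.Tier4.Line1.OrbitalTools
import Summits.Ventures.HodgeRepro.Tier4.Line1.ConvTest
import Summits.Ventures.HodgeRepro.Tier4.Line1.OrbitalPositive
import Summits.Ventures.HodgeRepro.Tier4.Line1.OrbitalNonzero
import Summits.Ventures.HodgeRepro.Tier4.Line1.SecondCountableGA
import Summits.Ventures.HodgeRepro.Tier4.Line1.RealisedSetting
import Summits.Ventures.HodgeRepro.Tier4.Line1.CompactAverage

/-!
# Tier4/Line1/IsolatingTestsLevel — F2′: the isolating test function of J2 taken BI-INVARIANT under a compact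
subgroup `K` (the level), DEFINED and sorry-free: `∃ V ∈ 𝓝 1, ∀ K compact ⊆ V, ∃ f₁ f₂ o₀, …isolation… ∧ f₁
bi-`K`-invariant`, and the consequence that `Hit (cj f₁) (τ m)` then yields a non-zero `K`-FIXED vector in `τ m`

Blind re-derivation cell `pub-hodge-repro`, Tier 4 (README §9–§10), seat t4-L1-p3 (gen 2); planner's cut t4-plan-1 g2
S13462 (4), lead S13467.  Target tree path `lean/Summits/Ventures/HodgeRepro/Tier4/Line1/IsolatingTestsLevel.lean`.
Imports LINE L1's generic layer (`RTFSetting`) and t4-L1-p2's J2.c′ modules BY NAME — `OrbitalTools`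
(`finite_hit_closure`, `eq_zero_of_notMem_hit`, the Lipschitz estimate `norm_orbital_sub_le`), `ConvTest`
(`IsTest.exists_nhds_norm_sub_lt`), `OrbitalPositive` (`exists_test_orbital_re_pos`), `OrbitalNonzero`
(`exists_conv_orbital_close`) — this seat's `CompactAverage` (`haarK`, `avgR`, `avgL` and their lemmas) — and, for the instance, this seat's
`RealisedSetting` (`Setting.ofAdelic`, `exists_isolating_nbhd`, `exists_regular_rational`) with p5's `SecondCountableGA`.

WHAT THIS IS (the line's F2′, Skeleton v0.34 docstring of J2: «`f₁` can be taken with the admissible projector `e_S`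
as its `S`-components — what makes the free pin `lift` true for the datum»).  The DEFINED part of that refinement
is the LEVEL: the isolating `f₁` can be taken bi-invariant under a compact subgroup `K` of the adelic group —
`f₁ (x k) = f₁ x = f₁ (k x)` for `k ∈ K` — so that the invariant subspace `τ m` hit by `f̄₁` contains a non-zero
`K`-fixed vector (`exists_right_invariant_of_hit`: `ψ := R f φ` is right-`K`-invariant when `f` is left-`K`-invariant,
by the left-invariance of Haar measure).  With `K` the level subgroup of the tower (a compact open subgroup of the
finite adelic group), «`τ m` has a `K`-fixed vector» is the level of `τ m`, and the free pin `lift` (F1 + F2) is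
then asked only for `K`-finite vectors of `τ m` — the hypothesis shape of the printed Rallis inner-product statement.
THE QUANTIFIER (why `∃ V ∀ K ⊆ V`, not a displayed arbitrary `K`): for a FIXED compact open `K` exact isolation
`geoSupport (f₁ ⋆ f₂) = {o₀}` with `f₁` bi-`K`-invariant is false in general — `supp f₁ ⊇ K γ₀ K` meets finitely
many but typically several rational double cosets (the skeleton's «at fixed hyperspecial level no exact isolation
is possible; deep level needed»); the true statement is the TOWER one: a neighbourhood `V` of `1` such that EVERY
compact subgroup inside `V` works.  No openness of `K` is used (any compact subgroup is averaged): `K ≤ finitePart W`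
and «open in `finitePart W`» are the CONSUMER's choice when it instantiates the level; the existence of such `K`
inside every `V` (the basis of compact open subgroups of the finite adelic group) is that consumer's input, not a
claim of this file.
THE PROOF (no print): `f₀` from p2's `exists_test_orbital_re_pos` (`0 < Re O(f₀)`, `tsupport f₀ ⊆ U`); the two-sided
average `avgL K (avgR K f₀)` over the Haar probability measure `haarK` of the compact group `K`
(`avgR f x := ∫_K f (x k)`, `avgL g x := ∫_K g (k⁻¹ x)`) is bi-`K`-invariant by the LEFT-invariance of `haarK` alone
(`integral_mul_left_eq_self`), continuous (`continuous_of_dominated`, bound `‖f₀‖_∞`), supported in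
`K · tsupport f₀ · K`, and within `2η` of `f₀` in sup norm when `K` lies in the uniform-continuity neighbourhoods
of `f₀` (`IsTest.exists_nhds_norm_sub_lt` and its left twin `exists_nhds_norm_sub_lt_left`); p2's Lipschitz estimate
`norm_orbital_sub_le` on the compact `A := W₃ · tsupport f₀ · W₀ ⊆ U` (separation by `compact_open_separated_mul_*`)
keeps `Re O(avg) > 0`, and p2's `exists_conv_orbital_close` supplies `f₂`.
Nothing here says anything about the status of the Hodge conjecture for CM abelian varieties, which is NOT proved
(HC_CM is NOT proved by anyone in this repository).
-/

set_option autoImplicit false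

noncomputable section

namespace Summit.Ventures.HodgeRepro.Tier4.Line1

namespace RTF

open MeasureTheory Topology Filter
open scoped Pointwise

variable {G : Type} [Group G] [TopologicalSpace G] [IsTopologicalGroup G] [MeasurableSpace G] [BorelSpace G]

namespace Setting

variable (S : Setting G)

/-- **A left-`K`-invariant test function hitting an invariant subspace produces a non-zero right-`K`-invariant
vector in it**: `ψ := R f φ ∈ V` (`IsInvariantSubspace.conv`), `ψ (x k) = ψ x` by the substitution `g ↦ k⁻¹ g` in
`∫ f(g) φ(x k g) dg` (left-invariance of Haar measure) and `f (k⁻¹ g) = f g`.  With `K` the level subgroup, this is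
«`τ m` has a non-zero `K`-fixed vector». -/
theorem exists_right_invariant_of_hit {V : Set (G → ℂ)} (hV : S.IsInvariantSubspace V) {f : G → ℂ}
    (hf : IsTest f) {K : Subgroup G} (hfK : ∀ k ∈ K, ∀ x, f (k * x) = f x) (h : S.Hit f V) :
    ∃ ψ ∈ V, (∃ x, ψ x ≠ 0) ∧ ∀ k ∈ K, ∀ x, ψ (x * k) = ψ x := by
  obtain ⟨φ, hφ, x₀, hx₀⟩ := h
  refine ⟨S.R f φ, hV.conv φ hφ f hf, ⟨x₀, hx₀⟩, ?_⟩
  intro k hk x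
  haveI : S.μ.IsMulLeftInvariant := S.haar.toIsMulLeftInvariant
  unfold Setting.R
  have := integral_mul_left_eq_self (μ := S.μ) (fun g => f g * φ (x * k * g)) k⁻¹
  rw [← this]
  congr 1
  funext g
  rw [hfK k⁻¹ (K.inv_mem hk) g]
  congr 2
  group

/-- **F2′ — the isolating pair of J2.c′ with `f₁` bi-invariant under every small compact subgroup** (generic over
every `RTF.Setting G`): there is a neighbourhood `V` of `1` such that for EVERY compact subgroup `K ⊆ V` there are
test functions `f₁`, `f₂` with `f₁ ⋆ f₂` a test function supported in `U`, non-zero orbital term on `[γ₀]`, and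
`f₁ (x k) = f₁ x = f₁ (k x)` for all `k ∈ K`. -/
theorem exists_pair_orbital_ne_zero_level [Countable S.Gk] [LocallyCompactSpace G] [T2Space G]
    [FirstCountableTopology G] {χ : S.T → ℂ} {χ' : S.T' → ℂ} (hχ : S.IsCharacter χ) (hχ' : S.IsCharacter' χ')
    (hZ : S.CentralMatch χ χ') (γ₀ : S.Gk)
    (hreg : ∀ t ∈ S.T, ∀ t' ∈ S.T', t⁻¹ * γ₀ * t' = γ₀ → t ∈ S.Z ∧ t' = t) {U : Set G} (hU : IsOpen U)
    (hγ : (γ₀ : G) ∈ U) :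
    ∃ V ∈ 𝓝 (1 : G), ∀ K : Subgroup G, IsCompact (K : Set G) → (K : Set G) ⊆ V →
      ∃ f₁ f₂ : G → ℂ, IsTest f₁ ∧ IsTest f₂ ∧ IsTest (S.conv f₁ f₂) ∧ tsupport (S.conv f₁ f₂) ⊆ U ∧
        S.orbital χ χ' (S.orbitOf γ₀) (S.conv f₁ f₂) ≠ 0 ∧
        ∀ k ∈ K, ∀ x, f₁ (x * k) = f₁ x ∧ f₁ (k * x) = f₁ x := by
  classical
  obtain ⟨f₀, h₀, hsub, hpos⟩ := S.exists_test_orbital_re_pos hχ hχ' hZ γ₀ hreg hU hγ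
  set ε : ℝ := (S.orbital χ χ' (S.orbitOf γ₀) f₀).re with hεdef
  -- separation: the compact `A = W₃ · tsupport f₀ · W₀ ⊆ U` with `W₀, W₃` compact neighbourhoods of `1`
  obtain ⟨W₁, hW₁n, hW₁⟩ := compact_open_separated_mul_right h₀.compact hU hsub
  obtain ⟨W₀, hW₀n, hW₀sub, hW₀c⟩ := local_compact_nhds hW₁n
  have hB : IsCompact (tsupport f₀ * W₀) := h₀.compact.mul hW₀c
  have hBU : tsupport f₀ * W₀ ⊆ U := (Set.mul_subset_mul_left hW₀sub).trans hW₁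
  obtain ⟨W₂, hW₂n, hW₂⟩ := compact_open_separated_mul_left hB hU hBU
  obtain ⟨W₃, hW₃n, hW₃sub, hW₃c⟩ := local_compact_nhds hW₂n
  have hAc : IsCompact (W₃ * (tsupport f₀ * W₀)) := hW₃c.mul hB
  have hAU : W₃ * (tsupport f₀ * W₀) ⊆ U := (Set.mul_subset_mul_right hW₃sub).trans hW₂
  have h1W₀ : (1 : G) ∈ W₀ := mem_of_mem_nhds hW₀n
  have h1W₃ : (1 : G) ∈ W₃ := mem_of_mem_nhds hW₃n
  have hf₀A : tsupport f₀ ⊆ W₃ * (tsupport f₀ * W₀) := fun x hx => by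
    have : x = 1 * (x * 1) := by simp
    rw [this]
    exact Set.mul_mem_mul h1W₃ (Set.mul_mem_mul hx h1W₀)
  -- the Lipschitz constant of the orbital term on `A`
  set Γ : Finset S.Gk := (S.finite_hit_closure hAc).toFinset with hΓdef
  set L : ℝ := (Γ.card : ℝ) * S.μT.real S.DT * S.μT'.real S.DT' with hL
  have hL0 : 0 ≤ L := by positivity
  set η : ℝ := ε / (4 * (L + 1)) with hηdef
  have hη : 0 < η := by positivity
  obtain ⟨VR, hVRn, hVR⟩ := h₀.exists_nhds_norm_sub_lt hη
  obtain ⟨VL, hVLn, hVL⟩ := h₀.exists_nhds_norm_sub_lt_left hη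
  refine ⟨VR ∩ VL ∩ W₀ ∩ W₃, inter_mem (inter_mem (inter_mem hVRn hVLn) hW₀n) hW₃n, ?_⟩
  intro K hKc hKV
  have hKR : (K : Set G) ⊆ VR := fun k hk => (hKV hk).1.1.1
  have hKL : (K : Set G) ⊆ VL := fun k hk => (hKV hk).1.1.2
  have hKW₀ : (K : Set G) ⊆ W₀ := fun k hk => (hKV hk).1.2
  have hKW₃ : (K : Set G) ⊆ W₃ := fun k hk => (hKV hk).2
  -- the two-sided average
  set g : G → ℂ := avgL K hKc (avgR K hKc f₀) with hgdef
  have hg : IsTest g := isTest_avg K hKc h₀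
  have hgA : tsupport g ⊆ W₃ * (tsupport f₀ * W₀) :=
    (tsupport_avg_subset K hKc h₀).trans (Set.mul_subset_mul hKW₃ (Set.mul_subset_mul_left hKW₀))
  have hgU : tsupport g ⊆ U := hgA.trans hAU
  -- the sup-norm estimate `‖g − f₀‖ ≤ 2η`
  have hbound : ∀ x, ‖g x - f₀ x‖ ≤ 2 * η := by
    intro x
    have hR : ‖avgR K hKc f₀ x - f₀ x‖ ≤ η :=
      norm_avgR_sub_le K hKc h₀ (fun y k hk => (hVR y k (hKR hk)).le) x
    have hLx : ‖avgL K hKc (avgR K hKc f₀) x - avgR K hKc f₀ x‖ ≤ η := by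
      apply norm_avgL_sub_le K hKc (continuous_avgR K hKc h₀)
      intro y k hk
      exact norm_avgR_sub_avgR_le K hKc h₀ (fun z => (hVL z k⁻¹ (hKL (K.inv_mem hk))).le) y
    calc ‖g x - f₀ x‖
        = ‖(avgL K hKc (avgR K hKc f₀) x - avgR K hKc f₀ x) + (avgR K hKc f₀ x - f₀ x)‖ := by
          rw [hgdef]; congr 1; ring
      _ ≤ ‖avgL K hKc (avgR K hKc f₀) x - avgR K hKc f₀ x‖ + ‖avgR K hKc f₀ x - f₀ x‖ := norm_add_le _ _
      _ ≤ η + η := add_le_add hLx hR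
      _ = 2 * η := by ring
  -- the orbital term of `g` stays away from `0`
  have hΓ₀ : ∀ γ : S.Gk, γ ∉ Γ → ∀ t ∈ closure S.DT, ∀ t' ∈ closure S.DT', f₀ ((t : G)⁻¹ * γ * t') = 0 :=
    fun γ hγ t ht t' ht' => S.eq_zero_of_notMem_hit hAc hf₀A hγ ht ht'
  have hΓg : ∀ γ : S.Gk, γ ∉ Γ → ∀ t ∈ closure S.DT, ∀ t' ∈ closure S.DT', g ((t : G)⁻¹ * γ * t') = 0 :=
    fun γ hγ t ht t' ht' => S.eq_zero_of_notMem_hit hAc hgA hγ ht ht'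
  have hclose : ‖S.orbital χ χ' (S.orbitOf γ₀) g - S.orbital χ χ' (S.orbitOf γ₀) f₀‖ ≤ L * (2 * η) := by
    calc ‖S.orbital χ χ' (S.orbitOf γ₀) g - S.orbital χ χ' (S.orbitOf γ₀) f₀‖
        ≤ (Γ.card : ℝ) * (2 * η) * S.μT.real S.DT * S.μT'.real S.DT' :=
          S.norm_orbital_sub_le hχ hχ' _ hg h₀ hΓg hΓ₀ hbound
      _ = L * (2 * η) := by rw [hL]; ring
  have hsmall : L * (2 * η) < ε / 2 := by
    rw [hηdef]
    have : L * (2 * (ε / (4 * (L + 1)))) = ε / 2 * (L / (L + 1)) := by field_simp; ring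
    rw [this]
    have hlt : L / (L + 1) < 1 := by rw [div_lt_one (by linarith)]; linarith
    have hε2 : 0 < ε / 2 := by positivity
    nlinarith
  have hOg : 0 < (S.orbital χ χ' (S.orbitOf γ₀) g).re := by
    have hre := Complex.abs_re_le_norm (S.orbital χ χ' (S.orbitOf γ₀) g - S.orbital χ χ' (S.orbitOf γ₀) f₀)
    rw [Complex.sub_re] at hre
    have := abs_sub_abs_le_abs_sub (S.orbital χ χ' (S.orbitOf γ₀) g).re (S.orbital χ χ' (S.orbitOf γ₀) f₀).re
    have hre' : |(S.orbital χ χ' (S.orbitOf γ₀) g).re - ε| < ε / 2 := lt_of_le_of_lt (hre.trans hclose) hsmall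
    rw [abs_lt] at hre'
    linarith
  -- the second factor
  obtain ⟨f₂, h₂, hconv, hconvU, hcl⟩ :=
    S.exists_conv_orbital_close hχ hχ' (S.orbitOf γ₀) hg hU hgU hOg
  refine ⟨g, f₂, hg, h₂, hconv, hconvU, ?_, fun k hk x => avg_invariant K hKc f₀ hk x⟩
  intro h0
  rw [h0, zero_sub, norm_neg] at hcl
  exact absurd (Complex.abs_re_le_norm _) (not_le.2 (lt_of_lt_of_le hcl (le_abs_self _)))

end Setting

end RTF

/-! ## The instance: isolating tests at every small level on `Setting.ofAdelic` -/

section Instance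

open NumberField Common MeasureTheory Topology

variable {k : Type} [Field k] [NumberField k] (W : PlaneData k) [MeasurableSpace (GA W)] [BorelSpace (GA W)]
  (hW : IsDefinite W) (hg : IsGenuineRow W) (R : RTFData W) (μ : Measure (GA W)) [μ.IsHaarMeasure]
  [R.μT.IsHaarMeasure] [R.μT'.IsHaarMeasure] (hT : IsCompact (closure R.DT)) (hT' : IsCompact (closure R.DT'))

/-- **F2′ on the instance — isolating test functions at every small level**: for the defined tori and characters
(continuous, unitary, N2) there is a neighbourhood `V` of `1` in `U(W)(𝔸_k)` such that for EVERY compact subgroup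
`K ⊆ V` there are test functions `f₁`, `f₂` and ONE rational double coset `o₀` with `f₁ ⋆ f₂` meeting exactly `o₀`
on `DT × DT′`, a non-zero orbital term, and `f₁` bi-`K`-invariant (= `exists_isolating_tests` + the level clause).
The consumer instantiates `K` as the level subgroup of the tower (a compact open subgroup of the finite adelic group
inside `V` — its existence is the consumer's input). -/
theorem exists_isolating_tests_level (hc : Continuous R.chi) (hu : ∀ a, ‖R.chi a‖ = 1)
    (hc' : Continuous R.chi') (hu' : ∀ a, ‖R.chi' a‖ = 1) :
    ∃ V ∈ 𝓝 (1 : GA W), ∀ K : Subgroup (GA W), IsCompact (K : Set (GA W)) → (K : Set (GA W)) ⊆ V →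
      ∃ (f₁ f₂ : GA W → ℂ) (o₀ : (Setting.ofAdelic W hW hg R μ hT hT').Orbit),
        RTF.IsTest f₁ ∧ RTF.IsTest f₂ ∧ RTF.IsTest ((Setting.ofAdelic W hW hg R μ hT hT').conv f₁ f₂) ∧
        (Setting.ofAdelic W hW hg R μ hT hT').geoSupport ((Setting.ofAdelic W hW hg R μ hT hT').conv f₁ f₂) = {o₀} ∧
        (Setting.ofAdelic W hW hg R μ hT hT').orbital R.chi R.chi' o₀
          ((Setting.ofAdelic W hW hg R μ hT hT').conv f₁ f₂) ≠ 0 ∧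
        ∀ k ∈ K, ∀ x, f₁ (x * k) = f₁ x ∧ f₁ (k * x) = f₁ x := by
  haveI : Countable (Setting.ofAdelic W hW hg R μ hT hT').Gk := rationalPoints_countable W
  haveI : T2Space (GA W) := t2Space_GA W
  haveI : LocallyCompactSpace (GA W) := locallyCompact_GA W
  haveI : SecondCountableTopology (GA W) := secondCountable_GA W
  obtain ⟨γ₀, hreg⟩ := exists_regular_rational W hW hg
  have hreg' : IsRegularRational W γ₀ := isRegularRational_of_isLinRegular W γ₀ hreg
  obtain ⟨U, hU, hγU, hiso⟩ := exists_isolating_nbhd W hW hg R μ hT hT' γ₀ hreg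
  obtain ⟨V, hVn, hV⟩ := (Setting.ofAdelic W hW hg R μ hT hT').exists_pair_orbital_ne_zero_level
    (isCharacter_ofAdelic W hW hg R μ hT hT' hc hu) (isCharacter'_ofAdelic W hW hg R μ hT hT' hc' hu')
    (centralMatch_ofAdelic W hW hg R μ hT hT') γ₀ hreg' hU hγU
  refine ⟨V, hVn, ?_⟩
  intro K hKc hKV
  obtain ⟨f₁, f₂, h₁, h₂, hconv, hsupp, hne, hinv⟩ := hV K hKc hKV
  refine ⟨f₁, f₂, (Setting.ofAdelic W hW hg R μ hT hT').orbitOf γ₀, h₁, h₂, hconv, ?_, hne, hinv⟩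
  ext o
  constructor
  · rintro ⟨t, ht, t', ht', γ, rfl, hγne⟩
    exact hiso t (subset_closure ht) t' (subset_closure ht') γ
      (hsupp (subset_tsupport _ (Function.mem_support.mpr hγne)))
  · intro ho
    rw [Set.mem_singleton_iff] at ho
    subst ho
    by_contra h
    exact hne ((Setting.ofAdelic W hW hg R μ hT hT').orbital_eq_zero_of_not_mem R.chi R.chi' h)

end Instance

end Summit.Ventures.HodgeRepro.Tier4.Line1

end
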